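import Summits.NavierStokesRegularity.FunctionalMining.StrainEigen
import HarnessLib

/-!
# FunctionalMining — Lemma L-λ typed: heat-flow coercivity of the strain-eigenvalue moments (dict seat, staged)

HONEST FRAMING. Search for candidate a priori estimates; no regularity claim. Nothing about
Navier–Stokes is proved or asserted in this file: every row is a `@[conjecture] def` (a NAMED `Prop`),
and the only theorems are bookkeeping (monotonicity in the constants, an exponent check).

WHAT IS TYPED. The no-go seat's classification of the 48 candidate rows of K0 shape `T_LD`
(`pub-nsfunc-nogo/SIEVELD.md` v1.8c, `sieveld/verdicts_TLD.json` sieveld-g12-1.8c; K0-FLAGS A12: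
18 HOLDS ∃κ / 6 conditional / 24 FALSE ∀κ / 0 undecided) leaves exactly ONE open lemma, on which the six
rows `ES.lam1.q | T_LD | G1` and `ES.neglam3.q | T_LD | G1` (`q = 2, 3, 4`) are conditional (SIEVELD §3.4,
Theorem G (ii) + the missing "coercive Poincaré step"):

**Lemma L-λ(q) (open; SIEVELD §3.4 / §3.4b).** `inf_u D₀(u) / F_q(u) > 0`, the infimum over smooth,
zero-mean, divergence-free `u` on the 3-torus, where `F_q(u) = ∫ λ₁(S_u)^q` (`S_u = sym ∇u`,
`λ₁ ≥ λ₂ ≥ λ₃` its eigenvalues; resp. `F_q = ∫ (−λ₃)^q`) and `D₀(u) := −(d/dt)|_{t=0⁺} F_q(e^{tΔ}u)` is the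
initial decay rate of `F_q` along the HEAT flow; equivalently `F_q(e^{tΔ}u) ≤ e^{−ct} F_q(u)` for some
`c > 0` and all `u, t`.

Here: `heatDissipation Φ v := sup_{t>0} (Φ v − Φ (v + tΔv)) / t` (a field quantity: no time, no
solution, no semigroup), `HeatCoercive Φ c := "c · Φ v ≤ heatDissipation Φ v for every smooth zero-mean
divergence-free v on T³"`, the rows `TopEigHeatCoercive q c` / `NegBotEigHeatCoercive q c` (`Φ = ∫(λ₁⁺)^q`,
`∫((−λ₃)⁺)^q` = the tree's `torusTopEigMoment q` / `torusNegBotEigMoment q` of `StrainEigen.lean`), and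
**`TopEigHeatCoercivePos q := ∃ c > 0, TopEigHeatCoercive q c` = Lemma L-λ(q) for the `λ₁` core**
(`NegBotEigHeatCoercivePos q` for the `−λ₃` core). Also typed, so that the conditional verdict has a Lean
reading: the six `T_LD` rows themselves, `TopEigMomentSaturatingLaw q κ := SaturatingLaw (∫(λ₁⁺)^q)
(σ := 2q−3) (γ := (3q−3)/(2q−3)) κ` (K0 exponents `σ_F = 2q−3`, `γ_F = 1 + q/σ_F`; at `q = 2` these are
the Lu–Doering exponents `σ = 1, γ = 3`, `topEig_TLD_exponents_two`), and the paper claim of SIEVELD §3.4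
as a named implication `TopEigTLDOfCoercive q := TopEigHeatCoercivePos q → ∃ κ, TopEigMomentSaturatingLaw q κ`
(nogo Theorem G (ii), N14; claimed on paper, two-party on paper for the unconditional rows; a
`@[conjecture] def`, not a theorem). STATUS (2026-08-22, prove seat gen 17): Theorem G (ii) is
KERNEL-CHECKED for every real `q ≥ 2` in the one-sided-derivative-value form —
`TopEig.topEigMoment_rate_le_of_heatCoercive`, `TopEig.negBotEigMoment_rate_le_of_heatCoercive`
(`TopEigSaturatingSup.lean`) and `topEigMoment_saturatingLawSup_of_heatCoercivePos`
(`SaturatingLawSup.lean`, law `SaturatingLawSup`); the `SaturatingLaw` (`IsRateBudget`) form typed here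
additionally demands differentiability of `s ↦ ∫(λ₁⁺)^q(S(u s))` along solutions
(`TopEig.topEigMomentSaturatingLaw_of_coercive_of_differentiable`). So the six `T_LD` rows of these cores
are kernel-conditional on Lemma L-λ alone, in the derivative-value form.

WHY `heatDissipation` IS `D₀` (elementary; [ours, bookkeeping]). For `q ≥ 1` the map `w ↦ F_q(w)` is
convex (`w ↦ S_w(x)` is linear, `λ₁` is convex on symmetric matrices, `r ↦ (r⁺)^q` is convex and
non-decreasing), so `g(t) := F_q(v + tΔv)` is convex and finite on `ℝ`; hence `(g 0 − g t)/t` is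
NON-INCREASING in `t > 0`, bounded above by the left quotient `(g(−1) − g 0)/1`, and its supremum over
`t > 0` is the one-sided derivative `−g′(0⁺)` (which exists). For smooth `v`, `F_q` is Lipschitz in the
`C¹` seminorm on `C¹`-bounded sets (`|λ₁(A)⁺ − λ₁(B)⁺| ≤ ‖A − B‖`) and `e^{tΔ}v = v + tΔv + O_{C¹}(t²)`, so
`−g′(0⁺) = −(d/dt)|_{0⁺} F_q(e^{tΔ}v) = D₀(v)` — the sup form needs no heat semigroup on `UnitAddTorus`.
For a functional that is NOT convex along the line `t ↦ v + tΔv` the sup is only an upper bound for the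
one-sided derivative (when the latter exists); every row below uses a convex core. Junk: `⨆` over an
unbounded or empty range is `0` (`Real.sSup` convention) — irrelevant on the smooth fields quantified over.

NORMALISATION. The tree's torus is the UNIT torus `UnitAddTorus d = (ℝ/ℤ)^d` with probability
measure; SIEVELD works on `(ℝ/2πℤ)³`. `R_q := D₀/F_q` scales like (wavenumber)², so
`R_q^{unit} = (2π)² · R_q^{SIEVELD}`; `∃ c > 0` is normalisation-free. In SIEVELD units (§3.4b): single
Fourier-shell fields `|k|² = K` have `R_q = qK` exactly; exact dissipation identity where `λ₁` is simple
`D₀ = q(q−1)∫λ₁^{q−2}|∇λ₁|² + 2q∫λ₁^{q−1} Σ_{j=2,3} (λ₁−λ_j)|e_j·∇e₁|²`; Proposition L-λ(η) (proved on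
paper, §3.4b (4)): on the class `λ₂ ≤ (1−η)λ₁` pointwise, `R₂ ≥ η/(6(1+√3)²)`; descent records (static
minimisation, no DNS): `inf R₂ ≤ 0.5799` (nogo record j105166, superseding the earlier `0.6328`),
`inf R₃ ≤ 0.8946`, `inf R₄ ≤ 1.0180` (K = 1 shell value `q`; kernel: every admissible rate is
`≤ 4π²q`, `TopEigHeatCoerciveRate`, and `0` is admissible, `TopEigHeatStable`),
zero-cost skeleton EMPTY in 3-D (§3.4b (4d)); the sharp-interface route to `inf = 0` is reduced to the
combinatorial question E2. Whether `inf R_q = 0` (the six rows FALSE ∀κ would NOT follow automatically —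
Theorem G (ii) is one-directional) or `> 0` (the six rows HOLD ∃κ) is OPEN.

[ours: `pub-nsfunc` dict seat g13, 2026-08-20; sources: nogo SIEVELD §0 Lemma 0, §1 Theorem H, §3.4,
§3.4b; K0 `dict/K0.json` v1.6 family ES; K0-FLAGS A12. No literature claim is made: L-λ is an
internally-minted OPEN QUESTION, not a cited fact.]
-/

noncomputable section

namespace Summit.NavierStokesRegularity.FunctionalMining

open MeasureTheory Set Literature.Analysis.FunctionSpaces Literature.Analysis.FluidPDE

variable {d : Type*} [Fintype d] [DecidableEq d]

/-! ### The heat dissipation of a functional at a field (static form of `D₀ = −V_F`) -/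

/-- **`heatDissipation Φ v = sup_{t>0} (Φ v − Φ (v + t·Δv)) / t`.** For a functional convex along the
line `t ↦ v + tΔv` (all heat-sieve-passing cores of SIEVELD §1: `|ω|^q, |S|^q, λ₁(S)^q, (−λ₃(S))^q`,
`q ≥ 1`, …) this is the one-sided derivative `−(d/dt)|_{0⁺} Φ(v + tΔv)`, and for smooth `v` and a
`C¹`-Lipschitz `Φ` it equals `D₀(v) = −(d/dt)|_{0⁺} Φ(e^{tΔ}v)` (module docstring). A FIELD quantity:
no time, no solution. Junk value `0` when the range is empty or unbounded. [ours, bookkeeping] -/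
def heatDissipation (Φ : (UnitAddTorus d → EuclideanSpace ℝ d) → ℝ)
    (v : UnitAddTorus d → EuclideanSpace ℝ d) : ℝ :=
  ⨆ t : {t : ℝ // 0 < t}, (Φ v - Φ (v + (t : ℝ) • Torus.laplacian v)) / (t : ℝ)

/-- **`HeatCoercive Φ c` — heat-flow coercivity of `Φ` at rate `c` on `T³`.** For `d = 3`
(`Fintype.card d = 3` inside the `Prop`, the convention of `FunctionalRateSupBound` / `IsRateBudget`):
every smooth, divergence-free, zero-mean field `v` has `c · Φ v ≤ heatDissipation Φ v`. For a convex
non-negative core this says `Φ(e^{tΔ}v) ≤ e^{−ct} Φ(v)` ("coercive Poincaré step" of SIEVELD §3.4);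
`c = 0` is the heat sieve `V_Φ ≤ 0` (SIEVELD §1). [ours, bookkeeping] -/
def HeatCoercive (Φ : (UnitAddTorus d → EuclideanSpace ℝ d) → ℝ) (c : ℝ) : Prop :=
  Fintype.card d = 3 → ∀ v : UnitAddTorus d → EuclideanSpace ℝ d,
    Torus.IsSmooth v → Torus.IsDivFree v → Torus.HasZeroMean v → c * Φ v ≤ heatDissipation Φ v

/-- A smaller rate is a weaker statement, for non-negative functionals. [ours, bookkeeping] -/
theorem HeatCoercive.mono {Φ : (UnitAddTorus d → EuclideanSpace ℝ d) → ℝ} {c c' : ℝ}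
    (h : HeatCoercive Φ c) (hΦ : ∀ v, 0 ≤ Φ v) (hc : c' ≤ c) : HeatCoercive Φ c' :=
  fun hd v hv hdiv hmean =>
    (mul_le_mul_of_nonneg_right hc (hΦ v)).trans (h hd v hv hdiv hmean)

/-- Coercivity at a non-negative rate contains the heat sieve: the heat dissipation is non-negative at
every smooth divergence-free zero-mean field. [ours, bookkeeping] -/
theorem HeatCoercive.heatDissipation_nonneg {Φ : (UnitAddTorus d → EuclideanSpace ℝ d) → ℝ} {c : ℝ}
    (h : HeatCoercive Φ c) (hΦ : ∀ v, 0 ≤ Φ v) (hc : 0 ≤ c) (hd : Fintype.card d = 3)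
    {v : UnitAddTorus d → EuclideanSpace ℝ d} (hv : Torus.IsSmooth v) (hdiv : Torus.IsDivFree v)
    (hmean : Torus.HasZeroMean v) : 0 ≤ heatDissipation Φ v :=
  (mul_nonneg hc (hΦ v)).trans (h hd v hv hdiv hmean)

/-- Rate `0` is exactly the (static) heat sieve. [ours, bookkeeping] -/
theorem heatCoercive_zero_iff (Φ : (UnitAddTorus d → EuclideanSpace ℝ d) → ℝ) :
    HeatCoercive Φ 0 ↔ (Fintype.card d = 3 → ∀ v : UnitAddTorus d → EuclideanSpace ℝ d,
      Torus.IsSmooth v → Torus.IsDivFree v → Torus.HasZeroMean v → 0 ≤ heatDissipation Φ v) := by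
  simp only [HeatCoercive, zero_mul]

/-! ### The rows: coercivity of the `λ₁` and `−λ₃` moments (K0 cores `ES.lam1.q`, `ES.neglam3.q`) -/

/-- **`TopEigHeatCoercive q c`**: `c ∫(λ₁⁺)^q ≤ D₀` for every smooth zero-mean divergence-free field on
`T³` — Lemma L-λ(q) for the `λ₁` core AT RATE `c`. In SIEVELD units the best rate is `inf_u R_q`
(`≤ 0.5799, 0.8946, 1.0180` at `q = 2, 3, 4` by static descent; `≥ η/(6(1+√3)²)` at `q = 2` on the
sub-class `λ₂ ≤ (1−η)λ₁`, Proposition L-λ(η)); unit-torus rates are `(2π)²` times these. OPEN for every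
`c > 0`. [ours; open question, SIEVELD §3.4b] -/
@[conjecture] def TopEigHeatCoercive (q c : ℝ) : Prop :=
  HeatCoercive (d := d) (torusTopEigMoment q) c

/-- **`NegBotEigHeatCoercive q c`**: the same for the `−λ₃` core `∫((−λ₃)⁺)^q` (the `−λ₃` core of `v`
is the `λ₁` core of `−v`, SIEVELD §3.4b; the two families are equivalent by `v ↦ −v`, not proved
here). [ours; open question] -/
@[conjecture] def NegBotEigHeatCoercive (q c : ℝ) : Prop :=
  HeatCoercive (d := d) (torusNegBotEigMoment q) c

/-- **Lemma L-λ(q), `λ₁` core (OPEN; SIEVELD §3.4 / §3.4b): `∃ c > 0, TopEigHeatCoercive q c`**, i.e.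
`inf { D₀(u)/∫λ₁^q : u smooth, zero-mean, div-free on T³ } > 0`. The ONLY open cell of the A12 `T_LD`
classification (rows `ES.lam1.q | T_LD | G1`, `q = 2, 3, 4`, conditional on it via `TopEigTLDOfCoercive`).
Known (paper, nogo): the (NP) compactness proof fails (`λ₁` can be constant with `S ≢ const`:
`u = (sin z, cos z, 0)` has `λ₁ ≡ ½` yet `D₀ = qF` there); a violating sequence must develop
near-biaxial points (`ess-sup λ₂/λ₁ → 1`, Corollary of Proposition L-λ(η)); laminates have `R₂ ≥ 2`;
no pointwise spectral test tensor proves it (dict g13 note). [ours; open question] -/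
@[conjecture] def TopEigHeatCoercivePos (q : ℝ) : Prop :=
  ∃ c : ℝ, 0 < c ∧ TopEigHeatCoercive (d := d) q c

/-- **Lemma L-λ(q), `−λ₃` core (OPEN): `∃ c > 0, NegBotEigHeatCoercive q c`** (rows
`ES.neglam3.q | T_LD | G1`, `q = 2, 3, 4`). [ours; open question] -/
@[conjecture] def NegBotEigHeatCoercivePos (q : ℝ) : Prop :=
  ∃ c : ℝ, 0 < c ∧ NegBotEigHeatCoercive (d := d) q c

/-- Monotonicity of the `λ₁` row in the rate. [ours, bookkeeping] -/
theorem TopEigHeatCoercive.mono {q c c' : ℝ} (h : TopEigHeatCoercive (d := d) q c) (hc : c' ≤ c) :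
    TopEigHeatCoercive (d := d) q c' :=
  HeatCoercive.mono h (torusTopEigMoment_nonneg q) hc

/-- Monotonicity of the `−λ₃` row in the rate. [ours, bookkeeping] -/
theorem NegBotEigHeatCoercive.mono {q c c' : ℝ} (h : NegBotEigHeatCoercive (d := d) q c)
    (hc : c' ≤ c) : NegBotEigHeatCoercive (d := d) q c' :=
  HeatCoercive.mono h (torusNegBotEigMoment_nonneg q) hc

/-! ### The six `T_LD` rows of the eigenvalue cores and the conditional verdict, typed -/

/-- K0 row **`ES.lam1.q | T_LD`**: `d/dt ∫λ₁^q ≤ κ ν^{−γ} (2ℰ) (∫λ₁^q)^{1+1/σ}` with the K0 exponents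
`σ = 2q − 3`, `γ = (3q − 3)/(2q − 3)` (`= 1 + q/σ`), along every zero-mean classical solution on `T³`
(the tree's `SaturatingLaw`). Verdict of record (A12): HOLDS ∃κ CONDITIONALLY on Lemma L-λ(q),
`q = 2, 3, 4`. [ours; named row, not asserted] -/
@[conjecture] def TopEigMomentSaturatingLaw (q κ : ℝ) : Prop :=
  SaturatingLaw (d := d) (torusTopEigMoment q) (2 * q - 3) ((3 * q - 3) / (2 * q - 3)) κ

/-- K0 row **`ES.neglam3.q | T_LD`** (same exponents). Verdict of record (A12): HOLDS ∃κ
CONDITIONALLY on Lemma L-λ(q) for the `−λ₃` core. [ours; named row, not asserted] -/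
@[conjecture] def NegBotEigMomentSaturatingLaw (q κ : ℝ) : Prop :=
  SaturatingLaw (d := d) (torusNegBotEigMoment q) (2 * q - 3) ((3 * q - 3) / (2 * q - 3)) κ

/-- At `q = 2` the K0 exponents of the eigenvalue cores are the Lu–Doering exponents `σ = 1`, `γ = 3`.
[ours, bookkeeping] -/
theorem topEig_TLD_exponents_two :
    (2 * (2 : ℝ) - 3 = 1) ∧ ((3 * (2 : ℝ) - 3) / (2 * 2 - 3) = 3) := by norm_num

/-- Larger `κ` is the weaker `λ₁` row. [ours, bookkeeping] -/
theorem TopEigMomentSaturatingLaw.mono_kappa {q κ κ' : ℝ}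
    (h : TopEigMomentSaturatingLaw (d := d) q κ) (hκ : κ ≤ κ') :
    TopEigMomentSaturatingLaw (d := d) q κ' :=
  SaturatingLaw.mono_kappa h (torusTopEigMoment_nonneg q) hκ

/-- Larger `κ` is the weaker `−λ₃` row. [ours, bookkeeping] -/
theorem NegBotEigMomentSaturatingLaw.mono_kappa {q κ κ' : ℝ}
    (h : NegBotEigMomentSaturatingLaw (d := d) q κ) (hκ : κ ≤ κ') :
    NegBotEigMomentSaturatingLaw (d := d) q κ' :=
  SaturatingLaw.mono_kappa h (torusNegBotEigMoment_nonneg q) hκ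

/-- **Theorem G (ii) of SIEVELD §3.4 for the `λ₁` core, as a NAMED implication:**
Lemma L-λ(q) ⇒ the row `ES.lam1.q | T_LD` holds for some κ (GN + CZ + Young + the coercive step; nogo
N14, claimed on paper for real `q ≥ 2`). The A12 verdict "HOLDS conditionally on L-λ" is the pair
(this implication, `TopEigHeatCoercivePos q` open). STATUS (2026-08-22, prove seat gen 17): KERNEL-CHECKED
for every real `q ≥ 2` in the ONE-SIDED-DERIVATIVE-VALUE form — `TopEig.topEigMoment_rate_le_of_heatCoercive`
(`TopEigSaturatingSup.lean`: `TopEigHeatCoercive q c`, `c > 0` ⇒ `∃ κ ≥ 0`, every one-sided derivative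
value `R` of `s ↦ ∫(λ₁⁺)^q(S(u s))` within the window of a zero-mean classical solution obeys
`R ≤ κ ν^{−γ} (2ℰ) (∫(λ₁⁺)^q)^{1+1/σ}`) and `topEigMoment_saturatingLawSup_of_heatCoercivePos`
(`SaturatingLawSup.lean`). The literal conclusion below uses `SaturatingLaw` = `IsRateBudget`, which in
addition DEMANDS differentiability of `s ↦ ∫(λ₁⁺)^q(S(u s))`; given that clause it follows
(`TopEig.topEigMomentSaturatingLaw_of_coercive_of_differentiable`), but the clause is not supplied by the
estimate for the non-smooth spectral weight (its one-sided derivatives exist and can differ where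
`λ₁ = λ₂ > 0` on a set of positive measure). [ours; kernel in derivative-value form, this `Prop` open as typed] -/
@[conjecture] def TopEigTLDOfCoercive (q : ℝ) : Prop :=
  TopEigHeatCoercivePos (d := d) q → ∃ κ : ℝ, TopEigMomentSaturatingLaw (d := d) q κ

/-- Theorem G (ii) for the `−λ₃` core, as a named implication. STATUS (2026-08-22): kernel-checked in
one-sided-derivative-value form, `TopEig.negBotEigMoment_rate_le_of_heatCoercive` /
`negBotEigMoment_saturatingLawSup_of_heatCoercivePos`; the `SaturatingLaw` form below additionally needs
the differentiability clause of `IsRateBudget`. [ours; kernel in derivative-value form, this `Prop` open as typed] -/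
@[conjecture] def NegBotEigTLDOfCoercive (q : ℝ) : Prop :=
  NegBotEigHeatCoercivePos (d := d) q → ∃ κ : ℝ, NegBotEigMomentSaturatingLaw (d := d) q κ

/-- Bookkeeping of the conditional verdict: the paper implication and the open lemma together give the
row for some κ, and then for all larger κ. [ours, bookkeeping] -/
theorem topEigMomentSaturatingLaw_of_coercive {q : ℝ} (hG : TopEigTLDOfCoercive (d := d) q)
    (hL : TopEigHeatCoercivePos (d := d) q) :
    ∃ κ₀ : ℝ, ∀ κ, κ₀ ≤ κ → TopEigMomentSaturatingLaw (d := d) q κ := by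
  obtain ⟨κ₀, hκ₀⟩ := hG hL
  exact ⟨κ₀, fun κ hκ => hκ₀.mono_kappa hκ⟩

end Summit.NavierStokesRegularity.FunctionalMining

end
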